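import Summits.HodgeConjecture.HodgeConjecture.Theorems.Ring2HypothesesDescent
import Summits.HodgeConjecture.HodgeConjecture.Theorems.PadicSemiregularLiftHodgeAbelianVarietiesUnconditionalCorners
import Literature.AlgebraicGeometry.HodgeTheory.LefschetzOneOneHolds
import Literature.AlgebraicGeometry.HodgeTheory.AbelianLowDimensionWeilReduction
import HarnessLib

/-!
# Ring 2 — hypotheses layer, descent axis: RUNGS under row b06 `AbsoluteHodgeImpliesAlgebraicAV`

HONEST FRAMING (page 1, verbatim the cell's standing line): **research route conditional on HC_CM; not a
corollary; Q11.4-sentence-2 already refuted in dim ≥ 3.** Nothing in this file proves a new case of the Hodge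
conjecture, and nothing here discharges the binder of record b06
(`Ring2.Hypotheses.AbsoluteHodgeImpliesAlgebraicAV`, `Ring2HypothesesDescent.lean`; OPEN, ≡ `HC_AV` modulo
Deligne 1982 Main Thm. 2.11): the binder table's numbers are unchanged («binders of record · discharged»).
`HC_CM` (`Theses.RankFourFaces.CMAbelianHodge`) does not occur in this file.

Seat `ring2-b06` of the cell `pub-hodge-ring2` (BINDER-OWNERS.md §6; dictionary owner typer2's audit §5.8:
"serve row b06 with RUNGS only — binder-free sub-cases of `AbsoluteHodgeImpliesAlgebraicAV`, labelled, M
unchanged"). A RUNG is the row's statement restricted to a sub-class of pairs `(A, p)` on which it is a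
THEOREM of the tree (binder-free, at most modulo refereed named facts displayed as hypotheses). Listed:

* RUNG b06-r1 (CORNERS, fact-free): codimension `p ≤ 1` or `p ≥ dim A - 1` — `p = 0` / `p ≥ dim A`
  (`Negative.mem_algebraicClasses_of_dim_le`), `p = 1` Lefschetz `(1,1)` (`lefschetzOneOne_rational_holds`),
  `p = dim A - 1 ≥ 2` hard Lefschetz (`nonempty_hardLefschetzNFold_holds`, `mem_algebraicClasses_of_lt_of_nonempty`)
  down to codimension `1`. Stated for all Hodge classes (`hodgeClass_algebraic_abelian_of_corner`), then for
  absolute Hodge classes.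
* RUNG b06-r2 (fact-free): `dim A ≤ 3` (`hodgeClasses_algebraic_of_dim_le_three_holds`; also a corollary of r1).
* RUNG b06-r3 (fact-free): the DIVISOR-GENERATED sector — abelian varieties whose Hodge classes are spanned by
  divisor monomials (`Unconditional.divisorClassesSpan_le_algebraicClasses_holds`; Mattuck's general abelian
  variety, products of elliptic curves, Tankeev–Ribet simple abelian varieties of prime dimension — the
  hypothesis is carried per variety, no such case is asserted here).
* RUNG b06-r4 (modulo two named facts, one UNREFEREED): `dim A ≤ 5`, from Moonen–Zarhin 1999 (tree fact
  `MoonenZarhin1999_hodgeClasses_abelian_dim_le_five_of_weilClassesFourfolds`, refereed) and the algebraicity of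
  the Weil classes of abelian fourfolds (tree fact `Markman2025_weilClasses_algebraic_abelianFourfold`,
  arXiv:2502.03415 Cor. 1.6.1 — PREPRINT, UNREFEREED), both hypotheses in Lean.
* EXACTNESS of the row against its rungs (modulo Deligne's theorem, fact c1
  `deligne1982_hodgeClasses_abelianVariety_absoluteHodge`, hypothesis in Lean): `AbsoluteHodgeImpliesAlgebraicAV`
  is EQUIVALENT to its DEEP-MIDDLE part `2 ≤ p`, `2p ≤ dim A` on Hodge classes
  (`absoluteHodgeImpliesAlgebraicAV_iff_deepMiddle_of_deligne`; the tree's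
  `Unconditional.hodgeAbelianVarieties_iff_deepMiddle_holds` composed with
  `hc_av_iff_absoluteHodgeImpliesAlgebraicAV_of_deligne`): a counterexample to row b06, if any, is an absolute
  Hodge class of codimension `2 ≤ p ≤ dim A / 2` on an abelian variety of dimension `≥ 4` — outside the
  corners r1, outside r2, and (granted r4's facts) of dimension `≥ 6`.

Every absolute Hodge class is a rational class of Hodge type `(p,p)` (Charles–Schnell Def. 11.2.3, `σ = id`;
tree lemmas `IsAbsoluteHodgeClass.isRationalClass` / `.isOfHodgeType`), so each rung is the corresponding
known case of the Hodge conjecture for abelian varieties read on absolute Hodge classes; no rung uses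
absoluteness (that is the honest content of "rung": the row's extra strength over `HC_AV` lies entirely in the
deep middle, where Deligne's theorem makes the two coincide).

References (bib keys): Deligne1982HodgeCycles (Intro pp. 5–7, Main Thm. 2.11), CharlesSchnell2014Notes
(Def. 11.2.3), VoisinHodgeI2002 (Thm. 6.25, Thm. 11.30), VoisinHodgeII2003 (§10.2.3 proof of Prop. 10.26),
KerrPearlstein2011 (§3.1), vanGeemen1994HodgeAV (§2.4), MoonenZarhin1999LowDim (Thms. 0.1–0.2),
Markman2025SurveySecant (§1.1, Cor. 1.3; preprint), HatcherAT2002 (Thm. 3.26).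
-/

set_option linter.dupNamespace false

noncomputable section

open CategoryTheory
open Literature.AlgebraicGeometry Literature.AlgebraicGeometry.Motives
open Literature.AlgebraicGeometry.HodgeTheory
open Literature.AlgebraicTopology.SingularHomology
open Summit.HodgeConjecture.HodgeConjecture.Theorems.HodgeAbelianVarieties

namespace Summit.HodgeConjecture.HodgeConjecture.Ring2.Hypotheses

/-! ## RUNG b06-r1: the corners `p ≤ 1`, `p ≥ dim A - 1` (fact-free) -/

/-- Codimension `q ≤ 1` on any smooth projective complex variety: rational `(q,q)` classes are algebraic
(`q = 0`: `hodgeConjectureFor_codim_zero`; `q = 1`: Lefschetz `(1,1)`, DISCHARGED in the tree as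
`lefschetzOneOne_rational_holds`). [cite: VoisinHodgeI2002, Thm. 11.30] -/
theorem hodgeClass_algebraic_of_codim_le_one {n : ℕ} {X : SchemeOver ℂ} (hX : IsSmoothProjective n X)
    {q : ℕ} (hq : q ≤ 1) (c : complexBetti X (2 * q)) (hc : IsRationalClass c)
    (hqq : IsOfHodgeType n X (2 * q) q q c) : c ∈ algebraicClasses X q := by
  rcases Nat.le_one_iff_eq_zero_or_eq_one.1 hq with rfl | rfl
  · exact hodgeConjectureFor_codim_zero c
  · exact lefschetzOneOne_rational_holds hX c hc hqq

/-- **RUNG b06-r1 on Hodge classes (fact-free): the CORNERS of an abelian variety.** On a complex abelian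
variety `A`, every rational `(p,p)` class of codimension `p ≤ 1` or `p + 1 ≥ dim A` is algebraic: `p = 0` and
`p ≥ dim A` by `Negative.mem_algebraicClasses_of_dim_le` (top degree / vanishing), `p = 1` by Lefschetz `(1,1)`,
and `p = dim A - 1 ≥ 2` by hard Lefschetz (`nonempty_hardLefschetzNFold_holds`: `L^{2p-n}` is a rational
isomorphism of type `(2p-n, 2p-n)` preserving algebraicity, `mem_algebraicClasses_of_lt_of_nonempty`) down to
codimension `dim A - p ≤ 1`. [cite: VoisinHodgeI2002, Thm. 6.25 and Thm. 11.30] [cite: KerrPearlstein2011, §3.1] -/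
theorem hodgeClass_algebraic_abelian_of_corner (A : AbelianVariety ℂ) {p : ℕ} (hp : p ≤ 1 ∨ A.dim ≤ p + 1)
    (c : complexBetti A.X (2 * p)) (hc : IsRationalClass c) (hpp : IsOfHodgeType A.dim A.X (2 * p) p p c) :
    c ∈ algebraicClasses A.X p := by
  have hX : IsSmoothProjective A.dim A.X := AbelianVariety.isSmoothProjective_holds
  by_cases h0 : p = 0 ∨ A.dim ≤ p
  · exact Negative.mem_algebraicClasses_of_dim_le A h0 c
  by_cases h1 : p ≤ 1
  · exact hodgeClass_algebraic_of_codim_le_one hX h1 c hc hpp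
  · -- `2 ≤ p = dim A - 1`: hard Lefschetz reduces to codimension `dim A - p = 1`
    have hnp : A.dim < 2 * p := by omega
    exact mem_algebraicClasses_of_lt_of_nonempty (nonempty_hardLefschetzNFold_holds A.dim A.X) hX hnp
      (fun c' hc' hpp' ↦ hodgeClass_algebraic_of_codim_le_one hX (by omega) c' hc' hpp') c hc hpp

/-- **RUNG b06-r1: `AbsoluteHodgeImpliesAlgebraicAV` holds in the corners `p ≤ 1`, `p + 1 ≥ dim A`**
(binder-free, fact-free; an absolute Hodge class is a rational `(p,p)` class, Charles–Schnell Def. 11.2.3 with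
`σ = id`). [cite: CharlesSchnell2014Notes, Def. 11.2.3] [cite: VoisinHodgeI2002, Thm. 6.25 and Thm. 11.30] -/
theorem absoluteHodge_algebraic_abelian_of_corner (A : AbelianVariety ℂ) {p : ℕ}
    (hp : p ≤ 1 ∨ A.dim ≤ p + 1) (c : complexBetti A.X (2 * p)) (hc : IsAbsoluteHodgeClass A.dim A.X p c) :
    c ∈ algebraicClasses A.X p :=
  hodgeClass_algebraic_abelian_of_corner A hp c hc.isRationalClass hc.isOfHodgeType

/-! ## RUNG b06-r2: `dim A ≤ 3` (fact-free) -/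

/-- **RUNG b06-r2: `AbsoluteHodgeImpliesAlgebraicAV` holds on abelian varieties of dimension `≤ 3`**
(binder-free, fact-free: the Hodge conjecture for curves, surfaces and threefolds, DISCHARGED in the tree as
`hodgeClasses_algebraic_of_dim_le_three_holds` — Lefschetz `(1,1)` and hard Lefschetz for threefolds).
[cite: VoisinHodgeII2003, §10.2.3 proof of Prop. 10.26] [cite: CharlesSchnell2014Notes, Def. 11.2.3] -/
theorem absoluteHodge_algebraic_abelian_of_dim_le_three (A : AbelianVariety ℂ) (hd : A.dim ≤ 3) (p : ℕ)
    (c : complexBetti A.X (2 * p)) (hc : IsAbsoluteHodgeClass A.dim A.X p c) : c ∈ algebraicClasses A.X p :=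
  hodgeClasses_algebraic_of_dim_le_three_holds hd AbelianVariety.isSmoothProjective_holds p c
    hc.isRationalClass hc.isOfHodgeType

/-! ## RUNG b06-r3: the divisor-generated sector (fact-free) -/

/-- **RUNG b06-r3: `AbsoluteHodgeImpliesAlgebraicAV` holds on every abelian variety whose Hodge classes are
spanned by divisor monomials** (`Dᵖ ⊗ ℂ = Bᵖ ⊗ ℂ` in every degree; van Geemen §2.4 "if `Dᵖ = Bᵖ`, then the
Hodge `(p,p)`-conjecture is true for `X`" — Mattuck's general abelian variety, products of elliptic curves,
Tankeev–Ribet), by the tree's unconditional `Unconditional.divisorClassesSpan_le_algebraicClasses_holds`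
(Lefschetz `(1,1)` and cup products with divisor classes on abelian varieties). The divisor-generation
hypothesis is carried PER VARIETY; no instance of it is asserted here. [cite: vanGeemen1994HodgeAV, §2.4] -/
theorem absoluteHodge_algebraic_abelian_of_divisorGenerated (A : AbelianVariety ℂ)
    (hDG : ∀ (p : ℕ) (c : complexBetti A.X (2 * p)), IsRationalClass c →
      IsOfHodgeType A.dim A.X (2 * p) p p c →
        c ∈ Literature.Barriers.HodgeConjecture.divisorClassesSpan A.X A.dim p)
    (p : ℕ) (c : complexBetti A.X (2 * p)) (hc : IsAbsoluteHodgeClass A.dim A.X p c) :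
    c ∈ algebraicClasses A.X p :=
  Unconditional.divisorClassesSpan_le_algebraicClasses_holds A p (hDG p c hc.isRationalClass hc.isOfHodgeType)

/-! ## RUNG b06-r4: `dim A ≤ 5` (modulo Moonen–Zarhin 1999 and the Weil classes of abelian fourfolds) -/

/-- **RUNG b06-r4: `AbsoluteHodgeImpliesAlgebraicAV` holds on abelian varieties of dimension `≤ 5`, GRANTED
two named facts** (hypotheses in Lean): Moonen–Zarhin 1999 — on abelian varieties of dimension `≤ 5` every
Hodge class is algebraic as soon as the Weil classes of abelian FOURFOLDS are (tree fact
`MoonenZarhin1999_hodgeClasses_abelian_dim_le_five_of_weilClassesFourfolds`, refereed: Math. Ann. 315, Thms.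
0.1–0.2, with Moonen–Zarhin 1995, Tankeev, Ramón Marí 2008, as combined by Markman) — and the algebraicity of
the Weil classes of every abelian fourfold of Weil type (tree fact `Markman2025_weilClasses_algebraic_abelianFourfold`,
Markman arXiv:2502.03415 Cor. 1.6.1 / arXiv:2509.23403 Thm. 1.2 — PREPRINT, UNREFEREED; the cases `ℚ(√-3)`,
`ℚ(i)` are Schoen 1988 / van Geemen 1994 §5, refereed). [cite: MoonenZarhin1999LowDim, Thm. 0.1 and Thm. 0.2]
[cite: Markman2025SurveySecant, Thm. 1.2 and Cor. 1.3 (preprint, unrefereed)] [cite: CharlesSchnell2014Notes, Def. 11.2.3] -/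
theorem absoluteHodge_algebraic_abelian_of_dim_le_five_of_moonenZarhin_of_markman
    (hMZ : MoonenZarhin1999_hodgeClasses_abelian_dim_le_five_of_weilClassesFourfolds)
    (hW₄ : Markman2025_weilClasses_algebraic_abelianFourfold)
    (A : AbelianVariety ℂ) (hd : A.dim ≤ 5) (p : ℕ) (c : complexBetti A.X (2 * p))
    (hc : IsAbsoluteHodgeClass A.dim A.X p c) : c ∈ algebraicClasses A.X p :=
  hMZ hW₄ A hd AbelianVariety.isSmoothProjective_holds p c hc.isRationalClass hc.isOfHodgeType

/-! ## Exactness: row b06 is its deep-middle part (modulo Deligne's theorem) -/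

/-- **Row b06 ≡ its DEEP MIDDLE, granted Deligne's theorem** (fact c1
`deligne1982_hodgeClasses_abelianVariety_absoluteHodge`, hypothesis in Lean):
`AbsoluteHodgeImpliesAlgebraicAV` holds iff on every complex abelian variety every rational `(p,p)` class with
`2 ≤ p` and `2p ≤ dim A` is algebraic. Composition of the dictionary's
`hc_av_iff_absoluteHodgeImpliesAlgebraicAV_of_deligne` (row b06 `↔ HC_AV`) with the tree's unconditional
`Unconditional.hodgeAbelianVarieties_iff_deepMiddle_holds` (`HC_AV ↔` its deep middle: corners as in RUNG
b06-r1). So a counterexample to row b06, if any, is a Hodge class of codimension `2 ≤ p ≤ dim A / 2` on an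
abelian variety of dimension `≥ 4`. [cite: Deligne1982HodgeCycles, Main Thm. 2.11]
[cite: VoisinHodgeI2002, Thm. 6.25 and Thm. 11.30] [cite: KerrPearlstein2011, §3.1] -/
theorem absoluteHodgeImpliesAlgebraicAV_iff_deepMiddle_of_deligne
    (hD : deligne1982_hodgeClasses_abelianVariety_absoluteHodge) :
    AbsoluteHodgeImpliesAlgebraicAV ↔
      ∀ (A : AbelianVariety ℂ) (p : ℕ), 2 ≤ p → 2 * p ≤ A.dim →
        ∀ c : complexBetti A.X (2 * p), IsRationalClass c →
          IsOfHodgeType A.dim A.X (2 * p) p p c → c ∈ algebraicClasses A.X p :=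
  (hc_av_iff_absoluteHodgeImpliesAlgebraicAV_of_deligne hD).symm.trans
    Unconditional.hodgeAbelianVarieties_iff_deepMiddle_holds

/-- **Deep-middle sufficiency for row b06, NO named fact**: if every absolute Hodge class in the deep middle
(`2 ≤ p`, `2p ≤ dim A`) of every abelian variety of dimension `≥ 4` is algebraic AND so is every Hodge class
there (the second clause is what hard Lefschetz needs to leave the deep middle; with Deligne's theorem the two
clauses coincide), then `AbsoluteHodgeImpliesAlgebraicAV`. Recorded in the weaker, fact-free form: the
deep-middle HODGE statement alone implies the row (through `HC_AV`, `absoluteHodgeImpliesAlgebraicAV_of_hc_av`).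
[cite: VoisinHodgeI2002, Thm. 6.25 and Thm. 11.30] [cite: CharlesSchnell2014Notes, Def. 11.2.3] -/
theorem absoluteHodgeImpliesAlgebraicAV_of_deepMiddle
    (h : ∀ (A : AbelianVariety ℂ) (p : ℕ), 2 ≤ p → 2 * p ≤ A.dim →
      ∀ c : complexBetti A.X (2 * p), IsRationalClass c →
        IsOfHodgeType A.dim A.X (2 * p) p p c → c ∈ algebraicClasses A.X p) :
    AbsoluteHodgeImpliesAlgebraicAV :=
  absoluteHodgeImpliesAlgebraicAV_of_hc_av (Unconditional.hodgeAbelianVarieties_iff_deepMiddle_holds.2 h)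

/-! ## Audit: nothing is decided here

No theorem above concludes `AbsoluteHodgeImpliesAlgebraicAV`, `HC_AV` or `HC_CM` outright: each rung carries
its restriction (`p ≤ 1 ∨ dim A ≤ p + 1`, `dim A ≤ 3`, divisor generation, `dim A ≤ 5` with two named facts)
or the deep-middle statement as a hypothesis. Axiom closures: the three standard axioms only. -/

#print axioms Summit.HodgeConjecture.HodgeConjecture.Ring2.Hypotheses.hodgeClass_algebraic_abelian_of_corner
#print axioms Summit.HodgeConjecture.HodgeConjecture.Ring2.Hypotheses.absoluteHodge_algebraic_abelian_of_dim_le_three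
#print axioms Summit.HodgeConjecture.HodgeConjecture.Ring2.Hypotheses.absoluteHodge_algebraic_abelian_of_dim_le_five_of_moonenZarhin_of_markman
#print axioms Summit.HodgeConjecture.HodgeConjecture.Ring2.Hypotheses.absoluteHodgeImpliesAlgebraicAV_iff_deepMiddle_of_deligne

end Summit.HodgeConjecture.HodgeConjecture.Ring2.Hypotheses

end
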